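import Literature.Analysis.FluidPDE.KatoBilinearEstimates
import Literature.Analysis.FluidPDE.MildSolution
import HarnessLib

/-!
# Kato's Picard iteration in the weighted classes `t^{1/4}L⁶ ∩ t^{1/2}L^∞` (dimension three)

Analysis/FluidPDE support file, third layer of the discharge of Kato's weighted local existence
theorem `Literature.Analysis.FluidPDE.kato_local_L3` (`MildL3Smooth.lean`; Kato 1984, Thm. 1;
Lemarié-Rieusset 2016, Thm. 7.5). For `ν > 0`, a (strongly measurable) datum `u₀ ∈ L³(E)`,
`dim E = 3`, and a time `T > 0` such that the free evolution `U(t) = e^{νtΔ}u₀`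
(`Fluid.heatTest ν u₀ t`) is small in Kato's class, `‖U(t)‖_{L⁶} ≤ α t^{-1/4}` on `(0, T)` with
`8 c α ν^{-3/4} ≤ 1` (`c` the bilinear constant of `KatoBilinearEstimates.lean`), the Picard
iterates `u_{n+1} = U - B(u_n, u_n)` of the Oseen integral equation,
`B(u, v)(t)(x) = ∫_{(0,t)} ∫ K(ν(t-τ), x-y)[u(τ,y), v(τ,y)] dy dτ`, converge **at every point**
of `(0, T) × E` to a jointly measurable field `u` with
`u(t)(x) = U(t)(x) - B(u, u)(t)(x)` for all `0 < t < T` and all `x`, and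
`‖u(t)‖_{L⁶} ≤ 2α t^{-1/4}`, `‖u(t)(x)‖ ≤ L t^{-1/2}` (`exists_kato_fixedPoint`). This is Kato
1984, §2 (the successive approximations (2.6) in the norms (2.1)–(2.2)) = Lemarié-Rieusset 2016,
proof of Thm. 7.5 (Picard in `Ỹ_{T,6}`, with the `L^∞` weight carried along as in the proof of
Thm. 15.1 (A)); the contraction is run in the norm `max (sup t^{1/4}‖·‖₆, θ sup t^{1/2}‖·‖_∞)`
with a datum-dependent `θ`, in which the bilinear constant is `θ`-independent.

Contents: measurability of the free and bilinear terms, absolute convergence and bilinearity of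
`B` on fields with Kato bounds, the one-step and difference estimates, the iteration, and the
pointwise limit.

## References

* T. Kato, *Strong `L^p`-solutions of the Navier–Stokes equation in `ℝ^m`, with applications to
  weak solutions*, Math. Z. 187 (1984) 471–480, §2.
* P. G. Lemarié-Rieusset, *The Navier–Stokes Problem in the 21st Century*, CRC Press 2016,
  Thm. 7.5 and its proof (PDF pp. 155–158); proof of Thm. 15.1 (A) (PDF p. 565).
-/

noncomputable section

open MeasureTheory TopologicalSpace Set Function Filter Topology InnerProductSpace Metric
open scoped RealInnerProductSpace ENNReal NNReal

namespace Literature.Analysis.FluidPDE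

variable {E : Type*} [NormedAddCommGroup E] [InnerProductSpace ℝ E] [FiniteDimensional ℝ E]
  [MeasurableSpace E] [BorelSpace E]

/-! ### The free term `U(t) = e^{νtΔ} u₀` -/

section Free

/-- **Joint measurability of the free term** `(t, x) ↦ e^{νtΔ}u₀(x)` (`Fluid.heatTest ν u₀`) for
strongly measurable `u₀` (Fubini measurability of the heat convolution; the slice `t ≤ 0` is
`u₀`). [folklore] -/
theorem measurable_uncurry_heatTest {u₀ : E → E} (hu₀ : StronglyMeasurable u₀) (ν : ℝ) :
    Measurable (uncurry (heatTest ν u₀)) := by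
  have hint : StronglyMeasurable (uncurry fun (q : ℝ × E) (y : E) =>
      UnboundedOperators.heatKernel (ν * q.1) y • u₀ (q.2 - y)) := by
    refine Measurable.stronglyMeasurable ?_
    have hK : Measurable (fun p : (ℝ × E) × E => UnboundedOperators.heatKernel (ν * p.1.1) p.2) :=
      measurable_heatKernel_uncurry.comp ((measurable_const.mul measurable_fst.fst).prodMk
        measurable_snd)
    have hu : Measurable (fun p : (ℝ × E) × E => u₀ (p.1.2 - p.2)) :=
      hu₀.measurable.comp (measurable_fst.snd.sub measurable_snd)
    exact hK.smul hu
  have h1 : Measurable (fun q : ℝ × E => ∫ y, UnboundedOperators.heatKernel (ν * q.1) y • u₀ (q.2 - y)) :=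
    hint.integral_prod_right'.measurable
  have h2 : Measurable (fun q : ℝ × E => u₀ q.2) := hu₀.measurable.comp measurable_snd
  have hset : MeasurableSet {q : ℝ × E | 0 < ν * q.1} :=
    measurableSet_lt measurable_const (measurable_const.mul measurable_fst)
  have heq : uncurry (heatTest ν u₀) = fun q : ℝ × E =>
      if 0 < ν * q.1 then ∫ y, UnboundedOperators.heatKernel (ν * q.1) y • u₀ (q.2 - y)
        else u₀ q.2 := by
    funext q
    simp only [uncurry, heatTest, heatFlow]
    split_ifs with h
    · rw [UnboundedOperators.heatExtension_apply]
    · rfl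
  rw [heq]
  exact Measurable.ite hset h1 h2

/-- **Pointwise bound of the free term**: `‖e^{νtΔ}u₀(x)‖ ≤ (4πνt)^{-1/2} ‖u₀‖_{L³}` for every
`x` and `t > 0` in dimension three (Hölder with the `L^{3/2}` size of the Gauss–Weierstrass
kernel; Kato 1984, (2.2) with `q = ∞`). [folklore] -/
theorem norm_heatTest_le_of_memLp_three (hE : Module.finrank ℝ E = 3) {ν : ℝ} (hν : 0 < ν)
    {u₀ : E → E} (hu₀ : MemLp u₀ 3 volume) {t : ℝ} (ht : 0 < t) (x : E) :
    ‖heatTest ν u₀ t x‖ ≤ (4 * Real.pi * (ν * t)) ^ (-(1 / 2 : ℝ)) * (eLpNorm u₀ 3 volume).toReal := by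
  have hνt : 0 < ν * t := mul_pos hν ht
  haveI hHC : (3 : ℝ≥0∞).HolderConjugate (ENNReal.conjExponent 3) := .conjExponent (by norm_num)
  haveI : (ENNReal.conjExponent 3).HolderConjugate 3 := inferInstance
  have hK : AEStronglyMeasurable (UnboundedOperators.heatKernel (E := E) (ν * t)) volume :=
    (UnboundedOperators.continuous_heatKernel _).aestronglyMeasurable
  have h1 := UnboundedOperators.enorm_convolution_lsmul_le_eLpNorm_mul_eLpNorm hK hu₀.1
    (ENNReal.conjExponent 3) 3 x
  have h2 := UnboundedOperators.eLpNorm_heatKernel_le (E := E) hνt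
    (ENNReal.HolderConjugate.one_le (ENNReal.conjExponent 3) 3)
  have hexp : ENNReal.ofReal ((4 * Real.pi * (ν * t)) ^ (-(Module.finrank ℝ E : ℝ) / 2)) ^
      (1 - (ENNReal.conjExponent 3)⁻¹).toReal =
      ENNReal.ofReal ((4 * Real.pi * (ν * t)) ^ (-(1 / 2 : ℝ))) := by
    rw [ENNReal.HolderConjugate.one_sub_inv (ENNReal.conjExponent 3) 3, ENNReal.toReal_inv,
      ENNReal.toReal_ofNat, hE, ENNReal.ofReal_rpow_of_nonneg (by positivity) (by norm_num),
      ← Real.rpow_mul (by positivity)]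
    norm_num
  rw [hexp] at h2
  have h3 : ‖heatTest ν u₀ t x‖ₑ ≤ ENNReal.ofReal ((4 * Real.pi * (ν * t)) ^ (-(1 / 2 : ℝ))) *
      eLpNorm u₀ 3 volume := by
    rw [heatTest_of_pos hν ht]
    exact h1.trans (mul_le_mul' h2 le_rfl)
  have hfin : ENNReal.ofReal ((4 * Real.pi * (ν * t)) ^ (-(1 / 2 : ℝ))) * eLpNorm u₀ 3 volume ≠ ⊤ :=
    ENNReal.mul_ne_top ENNReal.ofReal_ne_top hu₀.2.ne
  rw [← ofReal_norm] at h3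
  have h4 := ENNReal.toReal_mono hfin h3
  rwa [ENNReal.toReal_ofReal (norm_nonneg _), ENNReal.toReal_mul,
    ENNReal.toReal_ofReal (by positivity)] at h4

/-- **`L³` bound of the free term**: `‖e^{νtΔ}u₀‖_{L³} ≤ ‖u₀‖_{L³}` for all `t`. [folklore] -/
theorem eLpNorm_heatTest_three_le {ν : ℝ} {u₀ : E → E} (hu₀ : MemLp u₀ 3 volume) (t : ℝ) :
    eLpNorm (heatTest ν u₀ t) 3 volume ≤ eLpNorm u₀ 3 volume := by
  unfold heatTest
  rcases le_or_gt (ν * t) 0 with h | h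
  · rw [heatFlow_of_nonpos _ h]
  · rw [heatFlow_of_pos _ h]
    exact UnboundedOperators.eLpNorm_heatExtension_le_holds hu₀ (by norm_num) h

end Free

/-! ### The bilinear term: measurability, absolute convergence, bilinearity -/

section Bilinear

/-- **Joint measurability of the bilinear term** `(t, x) ↦ ∫_{(0,t)} ∫ K(ν(t-τ), x-y)[u, v] dy dτ`
for jointly measurable `u`, `v` (the time integral as an integral over `ℝ` of the indicator of
`{0 < τ < t}` times the jointly measurable inner integral; Fubini measurability twice). [folklore] -/
theorem measurable_uncurry_oseenDuhamel {u v : ℝ → E → E} (hum : Measurable (uncurry u))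
    (hvm : Measurable (uncurry v)) (ν : ℝ) :
    Measurable (uncurry fun (t : ℝ) (x : E) =>
      ∫ τ in Ioo 0 t, ∫ y, oseenKernel (ν * (t - τ)) (x - y) (u τ y) (v τ y)) := by
  have hu' : Measurable (fun q : ((ℝ × E) × ℝ) × E => u q.1.2 q.2) :=
    hum.comp (measurable_fst.snd.prodMk measurable_snd)
  have hv' : Measurable (fun q : ((ℝ × E) × ℝ) × E => v q.1.2 q.2) :=
    hvm.comp (measurable_fst.snd.prodMk measurable_snd)
  have h1 : Measurable (fun q : ((ℝ × E) × ℝ) × E =>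
      ((ν * (q.1.1.1 - q.1.2), q.1.1.2 - q.2, u q.1.2 q.2, v q.1.2 q.2) : ℝ × E × E × E)) :=
    (measurable_const.mul (measurable_fst.fst.fst.sub measurable_fst.snd)).prodMk
      ((measurable_fst.fst.snd.sub measurable_snd).prodMk (hu'.prodMk hv'))
  have hk := measurable_oseenKernel.comp h1
  have hFm := hk.stronglyMeasurable.integral_prod_right' (ν := (volume : Measure E))
  dsimp only [Function.comp_def] at hFm
  have hset : MeasurableSet {p : (ℝ × E) × ℝ | p.2 ∈ Ioo 0 p.1.1} := by
    have ha : MeasurableSet {p : (ℝ × E) × ℝ | 0 < p.2} := measurableSet_lt measurable_const measurable_snd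
    have hb : MeasurableSet {p : (ℝ × E) × ℝ | p.2 < p.1.1} :=
      measurableSet_lt measurable_snd measurable_fst.fst
    exact ha.inter hb
  have hGm := hFm.indicator hset
  have hB := hGm.integral_prod_right' (ν := (volume : Measure ℝ))
  have heq : (uncurry fun (t : ℝ) (x : E) =>
      ∫ τ in Ioo 0 t, ∫ y, oseenKernel (ν * (t - τ)) (x - y) (u τ y) (v τ y)) =
      fun q : ℝ × E => ∫ τ, ({p : (ℝ × E) × ℝ | p.2 ∈ Ioo 0 p.1.1}).indicator
        (fun p : (ℝ × E) × ℝ => ∫ y, oseenKernel (ν * (p.1.1 - p.2)) (p.1.2 - y) (u p.2 y) (v p.2 y))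
          (q, τ) := by
    funext q
    have h1 : (fun τ => ({p : (ℝ × E) × ℝ | p.2 ∈ Ioo 0 p.1.1}).indicator
        (fun p : (ℝ × E) × ℝ => ∫ y, oseenKernel (ν * (p.1.1 - p.2)) (p.1.2 - y) (u p.2 y) (v p.2 y))
          (q, τ)) = (Ioo 0 q.1).indicator fun τ =>
            ∫ y, oseenKernel (ν * (q.1 - τ)) (q.2 - y) (u τ y) (v τ y) := by
      funext τ
      by_cases hτ : τ ∈ Ioo 0 q.1
      · rw [indicator_of_mem hτ, indicator_of_mem (show (q, τ) ∈ {p : (ℝ × E) × ℝ | p.2 ∈ Ioo 0 p.1.1} from hτ)]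
      · rw [indicator_of_notMem hτ, indicator_of_notMem (show (q, τ) ∉ {p : (ℝ × E) × ℝ | p.2 ∈ Ioo 0 p.1.1} from hτ)]
    rw [h1, integral_indicator measurableSet_Ioo]
    rfl
  rw [heq]
  exact hB.measurable

/-- **Absolute convergence of the inner integral**: for `a ∈ L⁶` and `b` essentially bounded
(slices of fields in Kato's classes at a positive time), `y ↦ K(σ, x-y)[a(y), b(y)]` is integrable
for every `x`, `σ > 0` (domination by the envelope in `L^{6/5}` against `|a||b| ∈ L⁶`). [folklore] -/
theorem integrable_oseenKernel_slice {σ : ℝ} (hσ : 0 < σ) {a b : E → E} (ha : MemLp a 6 volume)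
    (hbm : AEStronglyMeasurable b volume) (hb : eLpNorm b ∞ volume < ∞) (x : E) :
    Integrable (fun y => oseenKernel σ (x - y) (a y) (b y)) volume := by
  haveI := holderTriple_sixFifths_six_one
  haveI h66 : ENNReal.HolderTriple 6 ∞ 6 := inferInstance
  obtain ⟨C, hC, hK⟩ := exists_norm_oseenKernel_le (E := E)
  set d : ℝ := (Module.finrank ℝ E : ℝ) with hd
  set Env : E → ℝ := fun z => C * (σ + ‖z‖ ^ 2) ^ (-((d + 1) / 2)) with hEnv
  have hEnv0 : ∀ z, 0 ≤ Env z := fun z => mul_nonneg hC.le (Real.rpow_nonneg (by positivity) _)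
  -- the envelope in `L^{6/5}`, the product `|a| |b|` in `L⁶`
  obtain ⟨B, hB0, hB⟩ := exists_eLpNorm_oseenEnvelope_le (E := E) hC.le (r := 6 / 5)
    (by
      rw [ENNReal.le_div_iff_mul_le (Or.inl (by norm_num)) (Or.inl (by norm_num))]
      norm_num)
    (ENNReal.div_ne_top (by norm_num) (by norm_num))
  have hEnvm : AEStronglyMeasurable Env volume :=
    (measurable_const.mul ((measurable_const.add (measurable_norm.pow_const 2)).pow
      measurable_const)).aestronglyMeasurable
  have hEnv_mem : MemLp Env (6 / 5) volume :=
    ⟨hEnvm, (hB σ hσ).trans_lt ENNReal.ofReal_lt_top⟩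
  have hEnv_x : MemLp (fun y => Env (x - y)) (6 / 5) volume :=
    hEnv_mem.comp_measurePreserving (Measure.measurePreserving_sub_left volume x)
  have hg_mem : MemLp (fun y => ‖a y‖ * ‖b y‖) 6 volume := by
    have h := MemLp.mul' (p := ∞) (q := 6) (r := 6) ha.norm ⟨hbm.norm, by rwa [eLpNorm_norm]⟩
    simpa only [mul_comm] using h
  have hprod : Integrable (fun y => Env (x - y) * (‖a y‖ * ‖b y‖)) volume :=
    memLp_one_iff_integrable.1 (hg_mem.mul' hEnv_x)
  refine hprod.mono' ?_ (Eventually.of_forall fun y => ?_)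
  · have h1 : Measurable (fun y : E => ((σ, x - y, ha.1.mk a y, hbm.mk b y) : ℝ × E × E × E)) :=
      measurable_const.prodMk ((measurable_const.sub measurable_id).prodMk
        ((ha.1.stronglyMeasurable_mk.measurable).prodMk hbm.stronglyMeasurable_mk.measurable))
    have h2 : AEStronglyMeasurable (fun y => oseenKernel σ (x - y) (ha.1.mk a y) (hbm.mk b y)) volume :=
      (measurable_oseenKernel.comp h1).aestronglyMeasurable
    refine h2.congr ?_
    filter_upwards [ha.1.ae_eq_mk, hbm.ae_eq_mk] with y hya hyb
    rw [← hya, ← hyb]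
  · calc ‖oseenKernel σ (x - y) (a y) (b y)‖
        ≤ C * (σ + ‖x - y‖ ^ 2) ^ (-((d + 1) / 2)) * ‖a y‖ * ‖b y‖ := hK hσ _ _ _
      _ = Env (x - y) * (‖a y‖ * ‖b y‖) := by rw [hEnv]; ring

/-- **Bilinearity of the double integral in the first slot** at a point `(t, x)`: if the inner
integrals for `(u, v)` and `(u', v)` converge absolutely for `τ ∈ (0, t)` and the resulting time
integrands are integrable on `(0, t)`, then
`B(u + u', v)(t)(x) = B(u, v)(t)(x) + B(u', v)(t)(x)`. [folklore] -/
theorem oseenDuhamel_add_left_apply {ν t : ℝ} {u u' v : ℝ → E → E} {x : E}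
    (hi : ∀ τ ∈ Ioo 0 t, Integrable (fun y => oseenKernel (ν * (t - τ)) (x - y) (u τ y) (v τ y)) volume)
    (hi' : ∀ τ ∈ Ioo 0 t, Integrable (fun y => oseenKernel (ν * (t - τ)) (x - y) (u' τ y) (v τ y)) volume)
    (hI : IntegrableOn (fun τ => ∫ y, oseenKernel (ν * (t - τ)) (x - y) (u τ y) (v τ y)) (Ioo 0 t) volume)
    (hI' : IntegrableOn (fun τ => ∫ y, oseenKernel (ν * (t - τ)) (x - y) (u' τ y) (v τ y)) (Ioo 0 t) volume) :
    ∫ τ in Ioo 0 t, ∫ y, oseenKernel (ν * (t - τ)) (x - y) ((u + u') τ y) (v τ y) =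
      (∫ τ in Ioo 0 t, ∫ y, oseenKernel (ν * (t - τ)) (x - y) (u τ y) (v τ y)) +
        ∫ τ in Ioo 0 t, ∫ y, oseenKernel (ν * (t - τ)) (x - y) (u' τ y) (v τ y) := by
  rw [← integral_add hI hI']
  refine setIntegral_congr_fun measurableSet_Ioo fun τ hτ => ?_
  simp only [Pi.add_apply]
  rw [← integral_add (hi τ hτ) (hi' τ hτ)]
  refine integral_congr_ae (Eventually.of_forall fun y => ?_)
  exact oseenKernel_add_left _ _ _ _ _

/-- **Bilinearity in the second slot**, same statement. [folklore] -/
theorem oseenDuhamel_add_right_apply {ν t : ℝ} {u v v' : ℝ → E → E} {x : E}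
    (hi : ∀ τ ∈ Ioo 0 t, Integrable (fun y => oseenKernel (ν * (t - τ)) (x - y) (u τ y) (v τ y)) volume)
    (hi' : ∀ τ ∈ Ioo 0 t, Integrable (fun y => oseenKernel (ν * (t - τ)) (x - y) (u τ y) (v' τ y)) volume)
    (hI : IntegrableOn (fun τ => ∫ y, oseenKernel (ν * (t - τ)) (x - y) (u τ y) (v τ y)) (Ioo 0 t) volume)
    (hI' : IntegrableOn (fun τ => ∫ y, oseenKernel (ν * (t - τ)) (x - y) (u τ y) (v' τ y)) (Ioo 0 t) volume) :
    ∫ τ in Ioo 0 t, ∫ y, oseenKernel (ν * (t - τ)) (x - y) (u τ y) ((v + v') τ y) =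
      (∫ τ in Ioo 0 t, ∫ y, oseenKernel (ν * (t - τ)) (x - y) (u τ y) (v τ y)) +
        ∫ τ in Ioo 0 t, ∫ y, oseenKernel (ν * (t - τ)) (x - y) (u τ y) (v' τ y) := by
  rw [← integral_add hI hI']
  refine setIntegral_congr_fun measurableSet_Ioo fun τ hτ => ?_
  simp only [Pi.add_apply]
  rw [← integral_add (hi τ hτ) (hi' τ hτ)]
  refine integral_congr_ae (Eventually.of_forall fun y => ?_)
  exact oseenKernel_add_right _ _ _ _ _

/-- **The double integral is odd in the first slot** (no convergence needed). [folklore] -/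
theorem oseenDuhamel_neg_left_apply (ν t : ℝ) (u v : ℝ → E → E) (x : E) :
    ∫ τ in Ioo 0 t, ∫ y, oseenKernel (ν * (t - τ)) (x - y) ((-u) τ y) (v τ y) =
      -∫ τ in Ioo 0 t, ∫ y, oseenKernel (ν * (t - τ)) (x - y) (u τ y) (v τ y) := by
  rw [← integral_neg]
  refine integral_congr_ae (Eventually.of_forall fun τ => ?_)
  simp only [Pi.neg_apply]
  rw [← integral_neg]
  refine integral_congr_ae (Eventually.of_forall fun y => ?_)
  exact oseenKernel_neg_left _ _ _ _

/-- **The double integral is odd in the second slot** (no convergence needed). [folklore] -/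
theorem oseenDuhamel_neg_right_apply (ν t : ℝ) (u v : ℝ → E → E) (x : E) :
    ∫ τ in Ioo 0 t, ∫ y, oseenKernel (ν * (t - τ)) (x - y) (u τ y) ((-v) τ y) =
      -∫ τ in Ioo 0 t, ∫ y, oseenKernel (ν * (t - τ)) (x - y) (u τ y) (v τ y) := by
  rw [← integral_neg]
  refine integral_congr_ae (Eventually.of_forall fun τ => ?_)
  simp only [Pi.neg_apply]
  rw [← integral_neg]
  refine integral_congr_ae (Eventually.of_forall fun y => ?_)
  exact oseenKernel_neg_right _ _ _ _

end Bilinear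

/-! ### One Picard step and differences of steps: Kato bounds -/

section Step

/-- A pointwise bound is an `L^∞` bound. [folklore] -/
theorem eLpNorm_top_le_ofReal_of_norm_le {X : Type*} [MeasurableSpace X] {μ : Measure X}
    {F : Type*} [NormedAddCommGroup F] {g : X → F} {M : ℝ} (h : ∀ x, ‖g x‖ ≤ M) :
    eLpNorm g ∞ μ ≤ ENNReal.ofReal M := by
  rw [eLpNorm_exponent_top]
  exact eLpNormEssSup_le_of_ae_bound (Eventually.of_forall h)

/-- Slices of fields in Kato's `L⁶` class are in `L⁶`. [folklore] -/
theorem memLp_six_of_kato {X : Type*} [MeasureSpace X] {F : Type*} [NormedAddCommGroup F]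
    [SecondCountableTopology F] [MeasurableSpace F] [BorelSpace F]
    {w : ℝ → X → F} (hwm : Measurable (uncurry w))
    {t₁ a : ℝ} (hw6 : ∀ t ∈ Ioo 0 t₁, eLpNorm (w t) 6 volume ≤ ENNReal.ofReal (a * t ^ (-(1 / 4 : ℝ))))
    {t : ℝ} (ht : t ∈ Ioo 0 t₁) : MemLp (w t) 6 volume :=
  ⟨(hwm.comp (measurable_const.prodMk measurable_id)).aestronglyMeasurable,
    (hw6 t ht).trans_lt ENNReal.ofReal_lt_top⟩

variable (hE : Module.finrank ℝ E = 3)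
include hE

/-- **Kato bounds of one Picard step** `F(w) = U - B(w, w)` (Kato 1984, §2, (2.3)–(2.5);
Lemarié-Rieusset 2016, proof of Thm. 7.5): there is an absolute `c` such that, if `w` is jointly
measurable with `‖w(t)‖_{L⁶} ≤ a t^{-1/4}` and `‖w(t)(x)‖ ≤ b t^{-1/2}` on `(0, t₁)`, and the free
term satisfies `‖U(t)‖_{L⁶} ≤ α₁ t^{-1/4}` there, then `F(w)` is jointly measurable,
`‖F(w)(t)‖_{L⁶} ≤ (α₁ + c ν^{-3/4} a²) t^{-1/4}` and
`‖F(w)(t)(x)‖ ≤ ((4πν)^{-1/2}‖u₀‖₃ + c ν^{-3/4} a b) t^{-1/2}` on `(0, t₁)`. [cite: Kato1984, §2 (2.3)–(2.5)] [cite: LemarieRieusset2016, Thm. 7.5 (proof)] -/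
theorem exists_kato_step_bounds :
    ∃ c : ℝ, 0 ≤ c ∧ ∀ {ν : ℝ}, 0 < ν → ∀ {u₀ : E → E}, StronglyMeasurable u₀ → MemLp u₀ 3 volume →
      ∀ {w : ℝ → E → E}, Measurable (uncurry w) → ∀ {t₁ a b α₁ : ℝ}, 0 ≤ a → 0 ≤ b → 0 ≤ α₁ →
        (∀ t ∈ Ioo 0 t₁, eLpNorm (w t) 6 volume ≤ ENNReal.ofReal (a * t ^ (-(1 / 4 : ℝ)))) →
        (∀ t ∈ Ioo 0 t₁, ∀ x, ‖w t x‖ ≤ b * t ^ (-(1 / 2 : ℝ))) →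
        (∀ t ∈ Ioo 0 t₁, eLpNorm (heatTest ν u₀ t) 6 volume ≤ ENNReal.ofReal (α₁ * t ^ (-(1 / 4 : ℝ)))) →
          Measurable (uncurry fun (t : ℝ) (x : E) => heatTest ν u₀ t x -
            ∫ τ in Ioo 0 t, ∫ y, oseenKernel (ν * (t - τ)) (x - y) (w τ y) (w τ y)) ∧
          (∀ t ∈ Ioo 0 t₁, eLpNorm (fun x => heatTest ν u₀ t x -
              ∫ τ in Ioo 0 t, ∫ y, oseenKernel (ν * (t - τ)) (x - y) (w τ y) (w τ y)) 6 volume ≤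
            ENNReal.ofReal ((α₁ + c * ν ^ (-(3 / 4 : ℝ)) * a * a) * t ^ (-(1 / 4 : ℝ)))) ∧
          (∀ t ∈ Ioo 0 t₁, ∀ x, ‖heatTest ν u₀ t x -
              ∫ τ in Ioo 0 t, ∫ y, oseenKernel (ν * (t - τ)) (x - y) (w τ y) (w τ y)‖ ≤
            ((4 * Real.pi * ν) ^ (-(1 / 2 : ℝ)) * (eLpNorm u₀ 3 volume).toReal +
              c * ν ^ (-(3 / 4 : ℝ)) * a * b) * t ^ (-(1 / 2 : ℝ))) := by
  obtain ⟨c₆, hc₆, H6⟩ := exists_eLpNorm_six_oseenDuhamel_le hE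
  obtain ⟨ci, hci, Hi⟩ := exists_norm_oseenDuhamel_le hE
  refine ⟨max c₆ ci, le_max_of_le_left hc₆,
    fun {ν} hν {u₀} hu₀m hu₀ {w} hwm {t₁ a b α₁} ha hb hα₁ hw6 hwi hU6 => ?_⟩
  have hUm := measurable_uncurry_heatTest hu₀m ν
  have hBm := measurable_uncurry_oseenDuhamel hwm hwm ν
  have hmeas : Measurable (uncurry fun (t : ℝ) (x : E) => heatTest ν u₀ t x -
      ∫ τ in Ioo 0 t, ∫ y, oseenKernel (ν * (t - τ)) (x - y) (w τ y) (w τ y)) := hUm.sub hBm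
  have hνpow : 0 ≤ ν ^ (-(3 / 4 : ℝ)) := Real.rpow_nonneg hν.le _
  refine ⟨hmeas, fun t ht => ?_, fun t ht x => ?_⟩
  · -- the `L⁶` bound
    have ht0 : 0 < t := ht.1
    have hw6' : ∀ τ ∈ Ioo 0 t, eLpNorm (w τ) 6 volume ≤ ENNReal.ofReal (a * τ ^ (-(1 / 4 : ℝ))) :=
      fun τ hτ => hw6 τ ⟨hτ.1, hτ.2.trans ht.2⟩
    have hB6 := H6 hν hwm hwm ha ha ht0 hw6' hw6'
    have hUs : AEStronglyMeasurable (heatTest ν u₀ t) volume :=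
      (measurable_slice hUm t).aestronglyMeasurable
    have hBs : AEStronglyMeasurable (fun x =>
        ∫ τ in Ioo 0 t, ∫ y, oseenKernel (ν * (t - τ)) (x - y) (w τ y) (w τ y)) volume :=
      (measurable_slice hBm t).aestronglyMeasurable
    calc eLpNorm (fun x => heatTest ν u₀ t x -
          ∫ τ in Ioo 0 t, ∫ y, oseenKernel (ν * (t - τ)) (x - y) (w τ y) (w τ y)) 6 volume
        ≤ eLpNorm (heatTest ν u₀ t) 6 volume + eLpNorm (fun x =>
            ∫ τ in Ioo 0 t, ∫ y, oseenKernel (ν * (t - τ)) (x - y) (w τ y) (w τ y)) 6 volume :=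
          eLpNorm_sub_le hUs hBs (by norm_num)
      _ ≤ ENNReal.ofReal (α₁ * t ^ (-(1 / 4 : ℝ))) +
            ENNReal.ofReal (c₆ * ν ^ (-(3 / 4 : ℝ)) * a * a * t ^ (-(1 / 4 : ℝ))) :=
          add_le_add (hU6 t ht) hB6
      _ = ENNReal.ofReal ((α₁ + c₆ * ν ^ (-(3 / 4 : ℝ)) * a * a) * t ^ (-(1 / 4 : ℝ))) := by
          rw [← ENNReal.ofReal_add (by positivity) (by positivity)]
          ring_nf
      _ ≤ ENNReal.ofReal ((α₁ + max c₆ ci * ν ^ (-(3 / 4 : ℝ)) * a * a) * t ^ (-(1 / 4 : ℝ))) := by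
          refine ENNReal.ofReal_le_ofReal ?_
          have h1 : c₆ * ν ^ (-(3 / 4 : ℝ)) * a * a ≤ max c₆ ci * ν ^ (-(3 / 4 : ℝ)) * a * a := by
            gcongr; exact le_max_left _ _
          have h2 : 0 ≤ t ^ (-(1 / 4 : ℝ)) := Real.rpow_nonneg ht0.le _
          nlinarith
  · -- the pointwise bound
    have ht0 : 0 < t := ht.1
    have hw6' : ∀ τ ∈ Ioo 0 t, eLpNorm (w τ) 6 volume ≤ ENNReal.ofReal (a * τ ^ (-(1 / 4 : ℝ))) :=
      fun τ hτ => hw6 τ ⟨hτ.1, hτ.2.trans ht.2⟩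
    have hwi' : ∀ τ ∈ Ioo 0 t, eLpNorm (w τ) ∞ volume ≤ ENNReal.ofReal (b * τ ^ (-(1 / 2 : ℝ))) :=
      fun τ hτ => eLpNorm_top_le_ofReal_of_norm_le (hwi τ ⟨hτ.1, hτ.2.trans ht.2⟩)
    have hBi := (Hi hν hwm hwm ha hb ht0 hw6' hwi' x).2
    have hU := norm_heatTest_le_of_memLp_three hE hν hu₀ ht0 x
    have hsplit : (4 * Real.pi * (ν * t)) ^ (-(1 / 2 : ℝ)) =
        (4 * Real.pi * ν) ^ (-(1 / 2 : ℝ)) * t ^ (-(1 / 2 : ℝ)) := by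
      rw [← mul_assoc, Real.mul_rpow (by positivity) ht0.le]
    rw [hsplit] at hU
    calc ‖heatTest ν u₀ t x - ∫ τ in Ioo 0 t, ∫ y, oseenKernel (ν * (t - τ)) (x - y) (w τ y) (w τ y)‖
        ≤ ‖heatTest ν u₀ t x‖ + ‖∫ τ in Ioo 0 t, ∫ y, oseenKernel (ν * (t - τ)) (x - y) (w τ y) (w τ y)‖ :=
          norm_sub_le _ _
      _ ≤ (4 * Real.pi * ν) ^ (-(1 / 2 : ℝ)) * t ^ (-(1 / 2 : ℝ)) * (eLpNorm u₀ 3 volume).toReal +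
            ci * ν ^ (-(3 / 4 : ℝ)) * a * b * t ^ (-(1 / 2 : ℝ)) := add_le_add hU hBi
      _ ≤ ((4 * Real.pi * ν) ^ (-(1 / 2 : ℝ)) * (eLpNorm u₀ 3 volume).toReal +
            max c₆ ci * ν ^ (-(3 / 4 : ℝ)) * a * b) * t ^ (-(1 / 2 : ℝ)) := by
          have h1 : ci * ν ^ (-(3 / 4 : ℝ)) * a * b ≤ max c₆ ci * ν ^ (-(3 / 4 : ℝ)) * a * b := by
            gcongr; exact le_max_right _ _
          have h2 : 0 ≤ t ^ (-(1 / 2 : ℝ)) := Real.rpow_nonneg ht0.le _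
          nlinarith

/-- **Kato bounds of differences of Picard steps** (Kato 1984, §2; Lemarié-Rieusset 2016, proof
of Thm. 7.5, the contraction estimate): there is an absolute `c` such that for jointly measurable
`w`, `w'` in Kato's classes on `(0, t₁)` (constants `(a, b)`, `(a', b')`) whose difference has
constants `(e, f)`, one has, on `(0, t₁) × E`, the bilinear identity
`B(w,w) - B(w',w') = B(w - w', w) + B(w', w - w')` (all integrals absolutely convergent) and the
bounds `‖(B(w,w) - B(w',w'))(t)‖_{L⁶} ≤ c ν^{-3/4} (e a + a' e) t^{-1/4}`,
`‖(B(w,w) - B(w',w'))(t)(x)‖ ≤ c ν^{-3/4} (e b + a' f) t^{-1/2}`. [cite: Kato1984, §2] [cite: LemarieRieusset2016, Thm. 7.5 (proof)] -/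
theorem exists_kato_diff_bounds :
    ∃ c : ℝ, 0 ≤ c ∧ ∀ {ν : ℝ}, 0 < ν → ∀ {w w' : ℝ → E → E}, Measurable (uncurry w) →
      Measurable (uncurry w') → ∀ {t₁ a b a' b' e f : ℝ}, 0 ≤ a → 0 ≤ b → 0 ≤ a' → 0 ≤ b' →
        0 ≤ e → 0 ≤ f →
        (∀ t ∈ Ioo 0 t₁, eLpNorm (w t) 6 volume ≤ ENNReal.ofReal (a * t ^ (-(1 / 4 : ℝ)))) →
        (∀ t ∈ Ioo 0 t₁, ∀ x, ‖w t x‖ ≤ b * t ^ (-(1 / 2 : ℝ))) →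
        (∀ t ∈ Ioo 0 t₁, eLpNorm (w' t) 6 volume ≤ ENNReal.ofReal (a' * t ^ (-(1 / 4 : ℝ)))) →
        (∀ t ∈ Ioo 0 t₁, ∀ x, ‖w' t x‖ ≤ b' * t ^ (-(1 / 2 : ℝ))) →
        (∀ t ∈ Ioo 0 t₁, eLpNorm ((w - w') t) 6 volume ≤ ENNReal.ofReal (e * t ^ (-(1 / 4 : ℝ)))) →
        (∀ t ∈ Ioo 0 t₁, ∀ x, ‖(w - w') t x‖ ≤ f * t ^ (-(1 / 2 : ℝ))) →
          (∀ t ∈ Ioo 0 t₁, ∀ x,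
            (∫ τ in Ioo 0 t, ∫ y, oseenKernel (ν * (t - τ)) (x - y) (w τ y) (w τ y)) -
              (∫ τ in Ioo 0 t, ∫ y, oseenKernel (ν * (t - τ)) (x - y) (w' τ y) (w' τ y)) =
            (∫ τ in Ioo 0 t, ∫ y, oseenKernel (ν * (t - τ)) (x - y) ((w - w') τ y) (w τ y)) +
              ∫ τ in Ioo 0 t, ∫ y, oseenKernel (ν * (t - τ)) (x - y) (w' τ y) ((w - w') τ y)) ∧
          (∀ t ∈ Ioo 0 t₁, eLpNorm (fun x =>
            (∫ τ in Ioo 0 t, ∫ y, oseenKernel (ν * (t - τ)) (x - y) (w τ y) (w τ y)) -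
              ∫ τ in Ioo 0 t, ∫ y, oseenKernel (ν * (t - τ)) (x - y) (w' τ y) (w' τ y)) 6 volume ≤
            ENNReal.ofReal (c * ν ^ (-(3 / 4 : ℝ)) * (e * a + a' * e) * t ^ (-(1 / 4 : ℝ)))) ∧
          (∀ t ∈ Ioo 0 t₁, ∀ x,
            ‖(∫ τ in Ioo 0 t, ∫ y, oseenKernel (ν * (t - τ)) (x - y) (w τ y) (w τ y)) -
              ∫ τ in Ioo 0 t, ∫ y, oseenKernel (ν * (t - τ)) (x - y) (w' τ y) (w' τ y)‖ ≤
            c * ν ^ (-(3 / 4 : ℝ)) * (e * b + a' * f) * t ^ (-(1 / 2 : ℝ))) := by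
  obtain ⟨c₆, hc₆, H6⟩ := exists_eLpNorm_six_oseenDuhamel_le hE
  obtain ⟨ci, hci, Hi⟩ := exists_norm_oseenDuhamel_le hE
  refine ⟨max c₆ ci, le_max_of_le_left hc₆, fun {ν} hν {w w'} hwm hwm' {t₁ a b a' b' e f}
    ha hb ha' hb' he hf hw6 hwi hw6' hwi' hd6 hdi => ?_⟩
  have hdm : Measurable (uncurry (w - w')) := hwm.sub hwm'
  have hνpow : 0 ≤ ν ^ (-(3 / 4 : ℝ)) := Real.rpow_nonneg hν.le _
  -- restriction of the bounds to `(0, t)`, `t < t₁`, and their `L^∞` forms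
  have R6 : ∀ {p : ℝ → E → E} {k : ℝ}, (∀ t ∈ Ioo 0 t₁, eLpNorm (p t) 6 volume ≤
      ENNReal.ofReal (k * t ^ (-(1 / 4 : ℝ)))) → ∀ {t : ℝ}, t ∈ Ioo 0 t₁ →
      ∀ τ ∈ Ioo 0 t, eLpNorm (p τ) 6 volume ≤ ENNReal.ofReal (k * τ ^ (-(1 / 4 : ℝ))) := by
    intro p k h t ht τ hτ
    exact h τ ⟨hτ.1, hτ.2.trans ht.2⟩
  have Ri : ∀ {p : ℝ → E → E} {k : ℝ}, (∀ t ∈ Ioo 0 t₁, ∀ x, ‖p t x‖ ≤ k * t ^ (-(1 / 2 : ℝ))) →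
      ∀ {t : ℝ}, t ∈ Ioo 0 t₁ →
      ∀ τ ∈ Ioo 0 t, eLpNorm (p τ) ∞ volume ≤ ENNReal.ofReal (k * τ ^ (-(1 / 2 : ℝ))) := by
    intro p k h t ht τ hτ
    exact eLpNorm_top_le_ofReal_of_norm_le (h τ ⟨hτ.1, hτ.2.trans ht.2⟩)
  -- inner integrability of a pair in the classes at `τ ∈ (0, t)`
  have Inner : ∀ {p q : ℝ → E → E} {k l : ℝ}, Measurable (uncurry p) → Measurable (uncurry q) →
      (∀ t ∈ Ioo 0 t₁, eLpNorm (p t) 6 volume ≤ ENNReal.ofReal (k * t ^ (-(1 / 4 : ℝ)))) →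
      (∀ t ∈ Ioo 0 t₁, ∀ x, ‖q t x‖ ≤ l * t ^ (-(1 / 2 : ℝ))) → ∀ {t : ℝ}, t ∈ Ioo 0 t₁ → ∀ (x : E),
      ∀ τ ∈ Ioo 0 t, Integrable (fun y => oseenKernel (ν * (t - τ)) (x - y) (p τ y) (q τ y)) volume := by
    intro p q k l hpm hqm hp6 hqi t ht x τ hτ
    have hτ₁ : τ ∈ Ioo 0 t₁ := ⟨hτ.1, hτ.2.trans ht.2⟩
    exact integrable_oseenKernel_slice (mul_pos hν (sub_pos.2 hτ.2)) (memLp_six_of_kato hpm hp6 hτ₁)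
      (measurable_slice hqm τ).aestronglyMeasurable
      ((eLpNorm_top_le_ofReal_of_norm_le (hqi τ hτ₁)).trans_lt ENNReal.ofReal_lt_top) x
  -- the identity
  have hident : ∀ t ∈ Ioo 0 t₁, ∀ x,
      (∫ τ in Ioo 0 t, ∫ y, oseenKernel (ν * (t - τ)) (x - y) (w τ y) (w τ y)) -
        (∫ τ in Ioo 0 t, ∫ y, oseenKernel (ν * (t - τ)) (x - y) (w' τ y) (w' τ y)) =
      (∫ τ in Ioo 0 t, ∫ y, oseenKernel (ν * (t - τ)) (x - y) ((w - w') τ y) (w τ y)) +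
        ∫ τ in Ioo 0 t, ∫ y, oseenKernel (ν * (t - τ)) (x - y) (w' τ y) ((w - w') τ y) := by
    intro t ht x
    have ht0 : 0 < t := ht.1
    -- `B(w, w) = B(w - w', w) + B(w', w)`
    have h1 : (∫ τ in Ioo 0 t, ∫ y, oseenKernel (ν * (t - τ)) (x - y) (w τ y) (w τ y)) =
        (∫ τ in Ioo 0 t, ∫ y, oseenKernel (ν * (t - τ)) (x - y) ((w - w') τ y) (w τ y)) +
          ∫ τ in Ioo 0 t, ∫ y, oseenKernel (ν * (t - τ)) (x - y) (w' τ y) (w τ y) := by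
      have h := oseenDuhamel_add_left_apply (u := w - w') (u' := w') (v := w) (ν := ν) (t := t) (x := x)
        (Inner hdm hwm hd6 hwi ht x) (Inner hwm' hwm hw6' hwi ht x)
        (Hi hν hdm hwm he hb ht0 (R6 hd6 ht) (Ri hwi ht) x).1
        (Hi hν hwm' hwm ha' hb ht0 (R6 hw6' ht) (Ri hwi ht) x).1
      rw [sub_add_cancel] at h
      exact h
    -- `B(w', w) = B(w', w - w') + B(w', w')`
    have h2 : (∫ τ in Ioo 0 t, ∫ y, oseenKernel (ν * (t - τ)) (x - y) (w' τ y) (w τ y)) =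
        (∫ τ in Ioo 0 t, ∫ y, oseenKernel (ν * (t - τ)) (x - y) (w' τ y) ((w - w') τ y)) +
          ∫ τ in Ioo 0 t, ∫ y, oseenKernel (ν * (t - τ)) (x - y) (w' τ y) (w' τ y) := by
      have h := oseenDuhamel_add_right_apply (u := w') (v := w - w') (v' := w') (ν := ν) (t := t) (x := x)
        (Inner hwm' hdm hw6' hdi ht x) (Inner hwm' hwm' hw6' hwi' ht x)
        (Hi hν hwm' hdm ha' hf ht0 (R6 hw6' ht) (Ri hdi ht) x).1
        (Hi hν hwm' hwm' ha' hb' ht0 (R6 hw6' ht) (Ri hwi' ht) x).1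
      rw [sub_add_cancel] at h
      exact h
    rw [h1, h2]
    abel
  refine ⟨hident, fun t ht => ?_, fun t ht x => ?_⟩
  · -- the `L⁶` bound of the difference
    have ht0 : 0 < t := ht.1
    have hB1 := H6 hν hdm hwm he ha ht0 (R6 hd6 ht) (R6 hw6 ht)
    have hB2 := H6 hν hwm' hdm ha' he ht0 (R6 hw6' ht) (R6 hd6 ht)
    have hm1 : AEStronglyMeasurable (fun x =>
        ∫ τ in Ioo 0 t, ∫ y, oseenKernel (ν * (t - τ)) (x - y) ((w - w') τ y) (w τ y)) volume :=
      (measurable_slice (measurable_uncurry_oseenDuhamel hdm hwm ν) t).aestronglyMeasurable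
    have hm2 : AEStronglyMeasurable (fun x =>
        ∫ τ in Ioo 0 t, ∫ y, oseenKernel (ν * (t - τ)) (x - y) (w' τ y) ((w - w') τ y)) volume :=
      (measurable_slice (measurable_uncurry_oseenDuhamel hwm' hdm ν) t).aestronglyMeasurable
    have heq : (fun x => (∫ τ in Ioo 0 t, ∫ y, oseenKernel (ν * (t - τ)) (x - y) (w τ y) (w τ y)) -
        ∫ τ in Ioo 0 t, ∫ y, oseenKernel (ν * (t - τ)) (x - y) (w' τ y) (w' τ y)) =
        fun x => (∫ τ in Ioo 0 t, ∫ y, oseenKernel (ν * (t - τ)) (x - y) ((w - w') τ y) (w τ y)) +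
          ∫ τ in Ioo 0 t, ∫ y, oseenKernel (ν * (t - τ)) (x - y) (w' τ y) ((w - w') τ y) :=
      funext fun x => hident t ht x
    rw [heq]
    calc eLpNorm (fun x => (∫ τ in Ioo 0 t, ∫ y, oseenKernel (ν * (t - τ)) (x - y) ((w - w') τ y) (w τ y)) +
          ∫ τ in Ioo 0 t, ∫ y, oseenKernel (ν * (t - τ)) (x - y) (w' τ y) ((w - w') τ y)) 6 volume
        ≤ _ := eLpNorm_add_le hm1 hm2 (by norm_num)
      _ ≤ ENNReal.ofReal (c₆ * ν ^ (-(3 / 4 : ℝ)) * e * a * t ^ (-(1 / 4 : ℝ))) +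
            ENNReal.ofReal (c₆ * ν ^ (-(3 / 4 : ℝ)) * a' * e * t ^ (-(1 / 4 : ℝ))) := add_le_add hB1 hB2
      _ = ENNReal.ofReal (c₆ * ν ^ (-(3 / 4 : ℝ)) * (e * a + a' * e) * t ^ (-(1 / 4 : ℝ))) := by
          rw [← ENNReal.ofReal_add (by positivity) (by positivity)]
          ring_nf
      _ ≤ ENNReal.ofReal (max c₆ ci * ν ^ (-(3 / 4 : ℝ)) * (e * a + a' * e) * t ^ (-(1 / 4 : ℝ))) := by
          refine ENNReal.ofReal_le_ofReal ?_
          have h2 : 0 ≤ ν ^ (-(3 / 4 : ℝ)) * (e * a + a' * e) * t ^ (-(1 / 4 : ℝ)) :=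
            mul_nonneg (by positivity) (Real.rpow_nonneg ht0.le _)
          calc c₆ * ν ^ (-(3 / 4 : ℝ)) * (e * a + a' * e) * t ^ (-(1 / 4 : ℝ))
              = c₆ * (ν ^ (-(3 / 4 : ℝ)) * (e * a + a' * e) * t ^ (-(1 / 4 : ℝ))) := by ring
            _ ≤ max c₆ ci * (ν ^ (-(3 / 4 : ℝ)) * (e * a + a' * e) * t ^ (-(1 / 4 : ℝ))) :=
                mul_le_mul_of_nonneg_right (le_max_left _ _) h2
            _ = _ := by ring
  · -- the pointwise bound of the difference
    have ht0 : 0 < t := ht.1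
    have hB1 := (Hi hν hdm hwm he hb ht0 (R6 hd6 ht) (Ri hwi ht) x).2
    have hB2 := (Hi hν hwm' hdm ha' hf ht0 (R6 hw6' ht) (Ri hdi ht) x).2
    rw [hident t ht x]
    calc ‖(∫ τ in Ioo 0 t, ∫ y, oseenKernel (ν * (t - τ)) (x - y) ((w - w') τ y) (w τ y)) +
          ∫ τ in Ioo 0 t, ∫ y, oseenKernel (ν * (t - τ)) (x - y) (w' τ y) ((w - w') τ y)‖
        ≤ _ := norm_add_le _ _
      _ ≤ ci * ν ^ (-(3 / 4 : ℝ)) * e * b * t ^ (-(1 / 2 : ℝ)) +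
            ci * ν ^ (-(3 / 4 : ℝ)) * a' * f * t ^ (-(1 / 2 : ℝ)) := add_le_add hB1 hB2
      _ = ci * (ν ^ (-(3 / 4 : ℝ)) * (e * b + a' * f) * t ^ (-(1 / 2 : ℝ))) := by ring
      _ ≤ max c₆ ci * (ν ^ (-(3 / 4 : ℝ)) * (e * b + a' * f) * t ^ (-(1 / 2 : ℝ))) :=
          mul_le_mul_of_nonneg_right (le_max_right _ _)
            (mul_nonneg (by positivity) (Real.rpow_nonneg ht0.le _))
      _ = max c₆ ci * ν ^ (-(3 / 4 : ℝ)) * (e * b + a' * f) * t ^ (-(1 / 2 : ℝ)) := by ring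

end Step

/-! ### The iteration and its pointwise limit -/

section Iteration

variable (hE : Module.finrank ℝ E = 3)
include hE

/-- **Kato's fixed point** (Kato 1984, Thm. 1 and §2, the successive approximations (2.6) in the
weighted norms (2.1)–(2.2); Lemarié-Rieusset 2016, Thm. 7.5 and its proof, PDF pp. 155–158).
There is an absolute constant `c > 0` such that: for `ν > 0`, a strongly measurable datum
`u₀ ∈ L³(E)` (`dim E = 3`), `T > 0` and `α > 0` with `c α ν^{-3/4} ≤ 1` and
`‖e^{νtΔ}u₀‖_{L⁶} ≤ α t^{-1/4}` for `t ∈ (0, T)`, there is a jointly measurable field `u` on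
`ℝ × E` with `u(0) = u₀`, solving the Oseen integral equation
`u(t)(x) = e^{νtΔ}u₀(x) - ∫_{(0,t)} ∫ K(ν(t-τ), x-y)[u(τ,y), u(τ,y)] dy dτ` at **every** point of
`(0, T) × E`, with `‖u(t)‖_{L⁶} ≤ 2α t^{-1/4}` and
`‖u(t)(x)‖ ≤ 2(α + (4πν)^{-1/2}‖u₀‖₃) t^{-1/2}`; moreover the `L⁶` bound localises: if
`c α₁ ν^{-3/4} ≤ 1` and `‖e^{νtΔ}u₀‖_{L⁶} ≤ α₁ t^{-1/4}` on `(0, t₁)`, `t₁ ≤ T`, then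
`‖u(t)‖_{L⁶} ≤ 2α₁ t^{-1/4}` on `(0, t₁)` (the iterates on `(0, t₁)` only see `(0, t₁)`). The
iterates converge at every point because the scheme contracts in the norm
`max(sup t^{1/4}‖·‖₆, θ sup_{t,x} t^{1/2}‖·‖)` (pointwise suprema), `θ = α/(α + (4πν)^{-1/2}‖u₀‖₃)`. [cite: Kato1984, Thm. 1 and §2] [cite: LemarieRieusset2016, Thm. 7.5 (proof, PDF pp. 155–158)] -/
theorem exists_kato_fixedPoint :
    ∃ c : ℝ, 0 < c ∧ ∀ {ν : ℝ}, 0 < ν → ∀ {u₀ : E → E}, StronglyMeasurable u₀ → MemLp u₀ 3 volume →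
      ∀ {T α : ℝ}, 0 < T → 0 < α → c * α * ν ^ (-(3 / 4 : ℝ)) ≤ 1 →
        (∀ t ∈ Ioo 0 T, eLpNorm (heatTest ν u₀ t) 6 volume ≤ ENNReal.ofReal (α * t ^ (-(1 / 4 : ℝ)))) →
        ∃ u : ℝ → E → E, Measurable (uncurry u) ∧ u 0 = u₀ ∧
          (∀ t ∈ Ioo 0 T, ∀ x, u t x = heatTest ν u₀ t x -
            ∫ τ in Ioo 0 t, ∫ y, oseenKernel (ν * (t - τ)) (x - y) (u τ y) (u τ y)) ∧
          (∀ t ∈ Ioo 0 T, eLpNorm (u t) 6 volume ≤ ENNReal.ofReal (2 * α * t ^ (-(1 / 4 : ℝ)))) ∧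
          (∀ t ∈ Ioo 0 T, ∀ x, ‖u t x‖ ≤
            2 * (α + (4 * Real.pi * ν) ^ (-(1 / 2 : ℝ)) * (eLpNorm u₀ 3 volume).toReal) *
              t ^ (-(1 / 2 : ℝ))) ∧
          (∀ {t₁ α₁ : ℝ}, t₁ ≤ T → 0 < α₁ → c * α₁ * ν ^ (-(3 / 4 : ℝ)) ≤ 1 →
            (∀ t ∈ Ioo 0 t₁, eLpNorm (heatTest ν u₀ t) 6 volume ≤
              ENNReal.ofReal (α₁ * t ^ (-(1 / 4 : ℝ)))) →
            ∀ t ∈ Ioo 0 t₁, eLpNorm (u t) 6 volume ≤ ENNReal.ofReal (2 * α₁ * t ^ (-(1 / 4 : ℝ)))) := by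
  obtain ⟨c₁, hc₁, S1⟩ := exists_kato_step_bounds hE
  obtain ⟨c₂, hc₂, S2⟩ := exists_kato_diff_bounds hE
  refine ⟨8 * (max c₁ c₂ + 1), by positivity, ?_⟩
  intro ν hν u₀ hu₀m hu₀ T α hT hα hsmall hU6
  -- ### constants
  set β₀ : ℝ := (4 * Real.pi * ν) ^ (-(1 / 2 : ℝ)) * (eLpNorm u₀ 3 volume).toReal with hβ₀
  have hβ₀0 : 0 ≤ β₀ := by positivity
  have hνp : 0 ≤ ν ^ (-(3 / 4 : ℝ)) := Real.rpow_nonneg hν.le _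
  set η : ℝ := (max c₁ c₂ + 1) * ν ^ (-(3 / 4 : ℝ)) with hη
  have hη0 : 0 ≤ η := by positivity
  have hc₁η : c₁ * ν ^ (-(3 / 4 : ℝ)) ≤ η := by
    rw [hη]; gcongr; linarith [le_max_left c₁ c₂]
  have hc₂η : c₂ * ν ^ (-(3 / 4 : ℝ)) ≤ η := by
    rw [hη]; gcongr; linarith [le_max_right c₁ c₂]
  have h8of : ∀ {α₁ : ℝ}, 8 * (max c₁ c₂ + 1) * α₁ * ν ^ (-(3 / 4 : ℝ)) ≤ 1 → 8 * η * α₁ ≤ 1 := by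
    intro α₁ h; rw [hη]; linarith
  have h8 : 8 * η * α ≤ 1 := h8of hsmall
  -- ### the scheme
  set F : (ℝ → E → E) → ℝ → E → E := fun w t x => heatTest ν u₀ t x -
    ∫ τ in Ioo 0 t, ∫ y, oseenKernel (ν * (t - τ)) (x - y) (w τ y) (w τ y) with hF
  set useq : ℕ → ℝ → E → E := fun n => F^[n] (heatTest ν u₀) with huseq
  have huseq0 : useq 0 = heatTest ν u₀ := rfl
  have huseq_succ : ∀ n, useq (n + 1) = F (useq n) := fun n => Function.iterate_succ_apply' F n _
  have huseq_succ_apply : ∀ n t x, useq (n + 1) t x = heatTest ν u₀ t x -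
      ∫ τ in Ioo 0 t, ∫ y, oseenKernel (ν * (t - τ)) (x - y) (useq n τ y) (useq n τ y) := by
    intro n t x; rw [huseq_succ]
  -- ### Kato bounds of the free term
  have hUm : Measurable (uncurry (heatTest ν u₀)) := measurable_uncurry_heatTest hu₀m ν
  have hUi : ∀ t : ℝ, 0 < t → ∀ x, ‖heatTest ν u₀ t x‖ ≤ β₀ * t ^ (-(1 / 2 : ℝ)) := by
    intro t ht x
    have h := norm_heatTest_le_of_memLp_three hE hν hu₀ ht x
    rwa [← mul_assoc, Real.mul_rpow (by positivity) ht.le, mul_right_comm] at h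
  -- ### (S3) uniform bounds on all iterates
  have bounds : ∀ {t₁ α₁ : ℝ}, 0 < α₁ → 8 * η * α₁ ≤ 1 →
      (∀ t ∈ Ioo 0 t₁, eLpNorm (heatTest ν u₀ t) 6 volume ≤ ENNReal.ofReal (α₁ * t ^ (-(1 / 4 : ℝ)))) →
      ∀ n, Measurable (uncurry (useq n)) ∧
        (∀ t ∈ Ioo 0 t₁, eLpNorm (useq n t) 6 volume ≤ ENNReal.ofReal (2 * α₁ * t ^ (-(1 / 4 : ℝ)))) ∧
        (∀ t ∈ Ioo 0 t₁, ∀ x, ‖useq n t x‖ ≤ 2 * (α₁ + β₀) * t ^ (-(1 / 2 : ℝ))) := by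
    intro t₁ α₁ hα₁ h8₁ hU₁ n
    induction n with
    | zero =>
      refine ⟨hUm, fun t ht => (hU₁ t ht).trans (ENNReal.ofReal_le_ofReal ?_), fun t ht x =>
        (hUi t ht.1 x).trans ?_⟩
      · have : 0 ≤ t ^ (-(1 / 4 : ℝ)) := Real.rpow_nonneg ht.1.le _
        nlinarith
      · have : 0 ≤ t ^ (-(1 / 2 : ℝ)) := Real.rpow_nonneg ht.1.le _
        nlinarith
    | succ n ih =>
      obtain ⟨hm, h6, hi⟩ := ih
      have h := S1 hν hu₀m hu₀ hm (t₁ := t₁) (a := 2 * α₁) (b := 2 * (α₁ + β₀)) (α₁ := α₁)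
        (by positivity) (by positivity) hα₁.le h6 hi hU₁
      rw [huseq_succ]
      refine ⟨h.1, fun t ht => (h.2.1 t ht).trans (ENNReal.ofReal_le_ofReal ?_), fun t ht x =>
        (h.2.2 t ht x).trans ?_⟩
      · have ht4 : 0 ≤ t ^ (-(1 / 4 : ℝ)) := Real.rpow_nonneg ht.1.le _
        have hkey : α₁ + c₁ * ν ^ (-(3 / 4 : ℝ)) * (2 * α₁) * (2 * α₁) ≤ 2 * α₁ := by
          have : c₁ * ν ^ (-(3 / 4 : ℝ)) * (2 * α₁) * (2 * α₁) ≤ η * (2 * α₁) * (2 * α₁) := by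
            gcongr
          nlinarith
        exact mul_le_mul_of_nonneg_right hkey ht4
      · have ht2 : 0 ≤ t ^ (-(1 / 2 : ℝ)) := Real.rpow_nonneg ht.1.le _
        have hkey : β₀ + c₁ * ν ^ (-(3 / 4 : ℝ)) * (2 * α₁) * (2 * (α₁ + β₀)) ≤ 2 * (α₁ + β₀) := by
          have : c₁ * ν ^ (-(3 / 4 : ℝ)) * (2 * α₁) * (2 * (α₁ + β₀)) ≤ η * (2 * α₁) * (2 * (α₁ + β₀)) := by
            gcongr
          nlinarith
        exact mul_le_mul_of_nonneg_right hkey ht2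
  -- the global instance
  have gb := fun n => bounds (t₁ := T) hα h8 hU6 n
  have hm : ∀ n, Measurable (uncurry (useq n)) := fun n => (gb n).1
  -- ### (S4) geometric decay of the differences
  have diffs : ∀ n,
      (∀ t ∈ Ioo 0 T, eLpNorm ((useq (n + 1) - useq n) t) 6 volume ≤
        ENNReal.ofReal (η * α ^ 2 * (1 / 2) ^ n * t ^ (-(1 / 4 : ℝ)))) ∧
      (∀ t ∈ Ioo 0 T, ∀ x, ‖(useq (n + 1) - useq n) t x‖ ≤
        η * α * (α + β₀) * (1 / 2) ^ n * t ^ (-(1 / 2 : ℝ))) := by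
    intro n
    induction n with
    | zero =>
      -- `u₁ - u₀ = -(B(U,U) - B(0,0))`
      have hz6 : ∀ t ∈ Ioo 0 T, eLpNorm ((0 : ℝ → E → E) t) 6 volume ≤ ENNReal.ofReal (0 * t ^ (-(1 / 4 : ℝ))) := by
        intro t ht; simp
      have hzi : ∀ t ∈ Ioo 0 T, ∀ x, ‖(0 : ℝ → E → E) t x‖ ≤ 0 * t ^ (-(1 / 2 : ℝ)) := by
        intro t ht x; simp
      have hd6 : ∀ t ∈ Ioo 0 T, eLpNorm ((heatTest ν u₀ - 0) t) 6 volume ≤ ENNReal.ofReal (α * t ^ (-(1 / 4 : ℝ))) := by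
        intro t ht; rw [sub_zero]; exact hU6 t ht
      have hdi : ∀ t ∈ Ioo 0 T, ∀ x, ‖(heatTest ν u₀ - 0) t x‖ ≤ β₀ * t ^ (-(1 / 2 : ℝ)) := by
        intro t ht x; rw [sub_zero]; exact hUi t ht.1 x
      have hzm : Measurable (uncurry (0 : ℝ → E → E)) := measurable_const
      have h := S2 hν hUm hzm (t₁ := T) hα.le hβ₀0 le_rfl le_rfl hα.le hβ₀0 hU6 (fun t ht x => hUi t ht.1 x) hz6 hzi hd6 hdi
      obtain ⟨hid, h6, hi⟩ := h
      have hB0 : ∀ t x, (∫ τ in Ioo 0 t, ∫ y, oseenKernel (ν * (t - τ)) (x - y)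
          ((0 : ℝ → E → E) τ y) ((0 : ℝ → E → E) τ y)) = 0 := by
        intro t x; simp
      have hrel : ∀ t x, (useq (0 + 1) - useq 0) t x =
          -((∫ τ in Ioo 0 t, ∫ y, oseenKernel (ν * (t - τ)) (x - y) (heatTest ν u₀ τ y) (heatTest ν u₀ τ y)) -
            ∫ τ in Ioo 0 t, ∫ y, oseenKernel (ν * (t - τ)) (x - y)
              ((0 : ℝ → E → E) τ y) ((0 : ℝ → E → E) τ y)) := by
        intro t x
        rw [hB0, sub_zero, Pi.sub_apply, Pi.sub_apply, huseq_succ_apply, huseq0]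
        abel
      refine ⟨fun t ht => ?_, fun t ht x => ?_⟩
      · have heq : (useq (0 + 1) - useq 0) t = -fun x =>
            ((∫ τ in Ioo 0 t, ∫ y, oseenKernel (ν * (t - τ)) (x - y) (heatTest ν u₀ τ y) (heatTest ν u₀ τ y)) -
              ∫ τ in Ioo 0 t, ∫ y, oseenKernel (ν * (t - τ)) (x - y)
                ((0 : ℝ → E → E) τ y) ((0 : ℝ → E → E) τ y)) := by
          funext x; rw [Pi.neg_apply]; exact hrel t x
        rw [heq, eLpNorm_neg]
        refine (h6 t ht).trans (ENNReal.ofReal_le_ofReal ?_)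
        have ht4 : 0 ≤ t ^ (-(1 / 4 : ℝ)) := Real.rpow_nonneg ht.1.le _
        have : c₂ * ν ^ (-(3 / 4 : ℝ)) * (α * α + 0 * α) ≤ η * α ^ 2 := by
          rw [zero_mul, add_zero, ← sq]; exact mul_le_mul_of_nonneg_right hc₂η (sq_nonneg _)
        calc c₂ * ν ^ (-(3 / 4 : ℝ)) * (α * α + 0 * α) * t ^ (-(1 / 4 : ℝ))
            ≤ η * α ^ 2 * t ^ (-(1 / 4 : ℝ)) := mul_le_mul_of_nonneg_right this ht4
          _ = η * α ^ 2 * (1 / 2) ^ 0 * t ^ (-(1 / 4 : ℝ)) := by rw [pow_zero, mul_one]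
      · rw [hrel t x, norm_neg]
        refine (hi t ht x).trans ?_
        have ht2 : 0 ≤ t ^ (-(1 / 2 : ℝ)) := Real.rpow_nonneg ht.1.le _
        have : c₂ * ν ^ (-(3 / 4 : ℝ)) * (α * β₀ + 0 * β₀) ≤ η * α * (α + β₀) := by
          rw [zero_mul, add_zero]
          calc c₂ * ν ^ (-(3 / 4 : ℝ)) * (α * β₀) ≤ η * (α * β₀) := mul_le_mul_of_nonneg_right hc₂η (by positivity)
            _ ≤ η * α * (α + β₀) := by
                have : 0 ≤ η * α * α := by positivity
                nlinarith
        calc c₂ * ν ^ (-(3 / 4 : ℝ)) * (α * β₀ + 0 * β₀) * t ^ (-(1 / 2 : ℝ))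
            ≤ η * α * (α + β₀) * t ^ (-(1 / 2 : ℝ)) := mul_le_mul_of_nonneg_right this ht2
          _ = η * α * (α + β₀) * (1 / 2) ^ 0 * t ^ (-(1 / 2 : ℝ)) := by rw [pow_zero, mul_one]
    | succ n ih =>
      obtain ⟨ih6, ihi⟩ := ih
      obtain ⟨_, hw6, hwi⟩ := gb (n + 1)
      obtain ⟨_, hw6', hwi'⟩ := gb n
      have h := S2 hν (hm (n + 1)) (hm n) (t₁ := T) (by positivity) (by positivity) (by positivity)
        (by positivity) (by positivity) (by positivity) hw6 hwi hw6' hwi' ih6 ihi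
      obtain ⟨hid, h6, hi⟩ := h
      have hrel : ∀ t x, (useq (n + 1 + 1) - useq (n + 1)) t x =
          -((∫ τ in Ioo 0 t, ∫ y, oseenKernel (ν * (t - τ)) (x - y) (useq (n + 1) τ y) (useq (n + 1) τ y)) -
            ∫ τ in Ioo 0 t, ∫ y, oseenKernel (ν * (t - τ)) (x - y) (useq n τ y) (useq n τ y)) := by
        intro t x
        rw [Pi.sub_apply, Pi.sub_apply, huseq_succ_apply, huseq_succ_apply]
        abel
      refine ⟨fun t ht => ?_, fun t ht x => ?_⟩
      · have heq : (useq (n + 1 + 1) - useq (n + 1)) t = -fun x =>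
            ((∫ τ in Ioo 0 t, ∫ y, oseenKernel (ν * (t - τ)) (x - y) (useq (n + 1) τ y) (useq (n + 1) τ y)) -
              ∫ τ in Ioo 0 t, ∫ y, oseenKernel (ν * (t - τ)) (x - y) (useq n τ y) (useq n τ y)) := by
          funext x; rw [Pi.neg_apply]; exact hrel t x
        rw [heq, eLpNorm_neg]
        refine (h6 t ht).trans (ENNReal.ofReal_le_ofReal ?_)
        have ht4 : 0 ≤ t ^ (-(1 / 4 : ℝ)) := Real.rpow_nonneg ht.1.le _
        set eN : ℝ := η * α ^ 2 * (1 / 2) ^ n with heN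
        have heN0 : 0 ≤ eN := by positivity
        have hkey : c₂ * ν ^ (-(3 / 4 : ℝ)) * (eN * (2 * α) + 2 * α * eN) ≤ η * α ^ 2 * (1 / 2) ^ (n + 1) := by
          calc c₂ * ν ^ (-(3 / 4 : ℝ)) * (eN * (2 * α) + 2 * α * eN)
              ≤ η * (eN * (2 * α) + 2 * α * eN) := mul_le_mul_of_nonneg_right hc₂η (by positivity)
            _ = (8 * η * α) * (eN * (1 / 2)) := by ring
            _ ≤ 1 * (eN * (1 / 2)) := mul_le_mul_of_nonneg_right h8 (by positivity)
            _ = η * α ^ 2 * (1 / 2) ^ (n + 1) := by rw [heN, pow_succ]; ring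
        exact mul_le_mul_of_nonneg_right hkey ht4
      · rw [hrel t x, norm_neg]
        refine (hi t ht x).trans ?_
        have ht2 : 0 ≤ t ^ (-(1 / 2 : ℝ)) := Real.rpow_nonneg ht.1.le _
        set eN : ℝ := η * α ^ 2 * (1 / 2) ^ n with heN
        set fN : ℝ := η * α * (α + β₀) * (1 / 2) ^ n with hfN
        have hkey : c₂ * ν ^ (-(3 / 4 : ℝ)) * (eN * (2 * (α + β₀)) + 2 * α * fN) ≤
            η * α * (α + β₀) * (1 / 2) ^ (n + 1) := by
          have hsum : eN * (2 * (α + β₀)) + 2 * α * fN = 4 * α * fN := by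
            rw [heN, hfN]; ring
          rw [hsum]
          calc c₂ * ν ^ (-(3 / 4 : ℝ)) * (4 * α * fN)
              ≤ η * (4 * α * fN) := mul_le_mul_of_nonneg_right hc₂η (by positivity)
            _ = (8 * η * α) * (fN * (1 / 2)) := by ring
            _ ≤ 1 * (fN * (1 / 2)) := mul_le_mul_of_nonneg_right h8 (by positivity)
            _ = η * α * (α + β₀) * (1 / 2) ^ (n + 1) := by rw [hfN, pow_succ]; ring
        exact mul_le_mul_of_nonneg_right hkey ht2
  -- ### (S5) pointwise convergence of the iterates
  have hdist : ∀ t ∈ Ioo 0 T, ∀ x, ∀ n, dist (useq n t x) (useq (n + 1) t x) ≤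
      (η * α * (α + β₀) * t ^ (-(1 / 2 : ℝ))) * (1 / 2 : ℝ) ^ n := by
    intro t ht x n
    rw [dist_comm, dist_eq_norm]
    have h := (diffs n).2 t ht x
    rw [Pi.sub_apply, Pi.sub_apply] at h
    calc ‖useq (n + 1) t x - useq n t x‖ ≤ η * α * (α + β₀) * (1 / 2 : ℝ) ^ n * t ^ (-(1 / 2 : ℝ)) := h
      _ = _ := by ring
  have hcauchy : ∀ t ∈ Ioo 0 T, ∀ x, CauchySeq (fun n => useq n t x) := fun t ht x =>
    cauchySeq_of_le_geometric (1 / 2 : ℝ) _ (by norm_num) (hdist t ht x)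
  -- the limit field
  set ulim : ℝ → E → E := fun t x =>
    if t ∈ Ioo 0 T then limUnder atTop (fun n => useq n t x) else heatTest ν u₀ t x with hulim
  have hconv : ∀ t ∈ Ioo 0 T, ∀ x, Tendsto (fun n => useq n t x) atTop (𝓝 (ulim t x)) := by
    intro t ht x
    have h := (hcauchy t ht x).tendsto_limUnder
    simp only [hulim, if_pos ht]
    exact h
  have htail_pt : ∀ n, ∀ t ∈ Ioo 0 T, ∀ x, ‖(useq n - ulim) t x‖ ≤
      2 * (η * α * (α + β₀)) * (1 / 2 : ℝ) ^ n * t ^ (-(1 / 2 : ℝ)) := by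
    intro n t ht x
    have h := dist_le_of_le_geometric_of_tendsto (1 / 2 : ℝ) _ (by norm_num) (hdist t ht x)
      (hconv t ht x) n
    rw [dist_eq_norm] at h
    rw [Pi.sub_apply, Pi.sub_apply]
    calc ‖useq n t x - ulim t x‖
        ≤ η * α * (α + β₀) * t ^ (-(1 / 2 : ℝ)) * (1 / 2 : ℝ) ^ n / (1 - 1 / 2) := h
      _ = _ := by ring
  -- measurability of the limit
  have hulim_m : Measurable (uncurry ulim) := by
    set S : Set (ℝ × E) := Ioo 0 T ×ˢ univ with hS
    have hSm : MeasurableSet S := measurableSet_Ioo.prod MeasurableSet.univ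
    set g : ℕ → ℝ × E → E := fun n q =>
      if q ∈ S then uncurry (useq n) q else uncurry (heatTest ν u₀) q with hg
    have hgm : ∀ n, Measurable (g n) := fun n => Measurable.ite hSm (hm n) hUm
    have hlim : Tendsto g atTop (𝓝 (uncurry ulim)) := by
      rw [tendsto_pi_nhds]
      intro q
      by_cases hq : q ∈ S
      · have hq1 : q.1 ∈ Ioo 0 T := (mem_prod.1 hq).1
        have h := hconv q.1 hq1 q.2
        have heq : (fun n => g n q) = fun n => useq n q.1 q.2 := by
          funext n; simp only [hg, if_pos hq, uncurry]
        rw [heq]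
        exact h
      · have heq : (fun n => g n q) = fun _ => heatTest ν u₀ q.1 q.2 := by
          funext n; simp only [hg, if_neg hq, uncurry]
        have hq1 : q.1 ∉ Ioo 0 T := fun h => hq (mem_prod.2 ⟨h, mem_univ _⟩)
        have hval : uncurry ulim q = heatTest ν u₀ q.1 q.2 := by
          simp only [uncurry, hulim, if_neg hq1]
        rw [heq, hval]
        exact tendsto_const_nhds
    exact measurable_of_tendsto_metrizable hgm hlim
  -- `u(0) = u₀`
  have hulim0 : ulim 0 = u₀ := by
    funext x
    have h0 : (0 : ℝ) ∉ Ioo 0 T := fun h => lt_irrefl _ h.1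
    simp only [hulim, if_neg h0, heatTest_zero_right]
  -- pointwise bound of the limit
  have hulim_i : ∀ t ∈ Ioo 0 T, ∀ x, ‖ulim t x‖ ≤ 2 * (α + β₀) * t ^ (-(1 / 2 : ℝ)) := by
    intro t ht x
    exact le_of_tendsto ((continuous_norm.tendsto _).comp (hconv t ht x))
      (Eventually.of_forall fun n => (gb n).2.2 t ht x)
  -- localised `L⁶` bound of the limit (Fatou)
  have hulim_6loc : ∀ {t₁ α₁ : ℝ}, t₁ ≤ T → 0 < α₁ → 8 * η * α₁ ≤ 1 →
      (∀ t ∈ Ioo 0 t₁, eLpNorm (heatTest ν u₀ t) 6 volume ≤ ENNReal.ofReal (α₁ * t ^ (-(1 / 4 : ℝ)))) →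
      ∀ t ∈ Ioo 0 t₁, eLpNorm (ulim t) 6 volume ≤ ENNReal.ofReal (2 * α₁ * t ^ (-(1 / 4 : ℝ))) := by
    intro t₁ α₁ ht₁ hα₁ h8₁ hU₁ t ht
    have htT : t ∈ Ioo 0 T := ⟨ht.1, ht.2.trans_le ht₁⟩
    have lb := fun n => bounds hα₁ h8₁ hU₁ n
    have hFatou := MeasureTheory.Lp.eLpNorm_lim_le_liminf_eLpNorm (p := (6 : ℝ≥0∞))
      (μ := (volume : Measure E)) (f := fun n => useq n t)
      (fun n => (measurable_slice (hm n) t).aestronglyMeasurable) (ulim t)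
      (Eventually.of_forall fun x => hconv t htT x)
    refine hFatou.trans (Filter.liminf_le_of_le (by isBoundedDefault) fun b hb => ?_)
    obtain ⟨n, hn⟩ := hb.exists
    exact hn.trans ((lb n).2.1 t ht)
  have hulim_6 : ∀ t ∈ Ioo 0 T, eLpNorm (ulim t) 6 volume ≤ ENNReal.ofReal (2 * α * t ^ (-(1 / 4 : ℝ))) :=
    hulim_6loc le_rfl hα h8 hU6
  -- `L⁶` tail: telescoping and Fatou
  have htele : ∀ n m, n ≤ m → ∀ t ∈ Ioo 0 T, eLpNorm ((useq n - useq m) t) 6 volume ≤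
      ENNReal.ofReal (η * α ^ 2 * (2 * (1 / 2 : ℝ) ^ n - 2 * (1 / 2 : ℝ) ^ m) * t ^ (-(1 / 4 : ℝ))) := by
    intro n m hnm t ht
    induction m, hnm using Nat.le_induction with
    | base => simp
    | succ m hnm ih =>
      have hsplit : (useq n - useq (m + 1)) t = (useq n - useq m) t + -((useq (m + 1) - useq m) t) := by
        funext x; simp only [Pi.sub_apply, Pi.add_apply, Pi.neg_apply]; abel
      have hm1 : AEStronglyMeasurable ((useq n - useq m) t) volume :=
        ((measurable_slice (hm n) t).sub (measurable_slice (hm m) t)).aestronglyMeasurable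
      have hm2 : AEStronglyMeasurable (-((useq (m + 1) - useq m) t)) volume :=
        ((measurable_slice (hm (m + 1)) t).sub (measurable_slice (hm m) t)).aestronglyMeasurable.neg
      have hpow : (1 / 2 : ℝ) ^ m ≤ (1 / 2 : ℝ) ^ n := pow_le_pow_of_le_one (by norm_num) (by norm_num) hnm
      have ht4 : 0 ≤ t ^ (-(1 / 4 : ℝ)) := Real.rpow_nonneg ht.1.le _
      rw [hsplit]
      calc eLpNorm ((useq n - useq m) t + -((useq (m + 1) - useq m) t)) 6 volume
          ≤ eLpNorm ((useq n - useq m) t) 6 volume + eLpNorm (-((useq (m + 1) - useq m) t)) 6 volume :=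
            eLpNorm_add_le hm1 hm2 (by norm_num)
        _ ≤ ENNReal.ofReal (η * α ^ 2 * (2 * (1 / 2 : ℝ) ^ n - 2 * (1 / 2 : ℝ) ^ m) * t ^ (-(1 / 4 : ℝ))) +
              ENNReal.ofReal (η * α ^ 2 * (1 / 2 : ℝ) ^ m * t ^ (-(1 / 4 : ℝ))) := by
            rw [eLpNorm_neg]; exact add_le_add ih ((diffs m).1 t ht)
        _ = ENNReal.ofReal (η * α ^ 2 * (2 * (1 / 2 : ℝ) ^ n - 2 * (1 / 2 : ℝ) ^ (m + 1)) * t ^ (-(1 / 4 : ℝ))) := by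
            rw [← ENNReal.ofReal_add (mul_nonneg (mul_nonneg (by positivity) (by linarith)) ht4)
              (by positivity)]
            congr 1
            rw [pow_succ]
            ring
  have htail6 : ∀ n, ∀ t ∈ Ioo 0 T, eLpNorm ((useq n - ulim) t) 6 volume ≤
      ENNReal.ofReal (2 * (η * α ^ 2) * (1 / 2 : ℝ) ^ n * t ^ (-(1 / 4 : ℝ))) := by
    intro n t ht
    have hms : ∀ m, AEStronglyMeasurable ((useq n - useq m) t) volume := fun m =>
      ((measurable_slice (hm n) t).sub (measurable_slice (hm m) t)).aestronglyMeasurable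
    have hFatou := MeasureTheory.Lp.eLpNorm_lim_le_liminf_eLpNorm (p := (6 : ℝ≥0∞))
      (μ := (volume : Measure E)) (f := fun m => (useq n - useq m) t) hms ((useq n - ulim) t)
      (Eventually.of_forall fun x => by
        simp only [Pi.sub_apply]
        exact tendsto_const_nhds.sub (hconv t ht x))
    refine hFatou.trans (Filter.liminf_le_of_le (by isBoundedDefault) fun b hb => ?_)
    obtain ⟨m, hbm, hnm⟩ := (hb.and (eventually_ge_atTop n)).exists
    refine hbm.trans ((htele n m hnm t ht).trans (ENNReal.ofReal_le_ofReal ?_))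
    have ht4 : 0 ≤ t ^ (-(1 / 4 : ℝ)) := Real.rpow_nonneg ht.1.le _
    have : η * α ^ 2 * (2 * (1 / 2 : ℝ) ^ n - 2 * (1 / 2 : ℝ) ^ m) ≤ 2 * (η * α ^ 2) * (1 / 2 : ℝ) ^ n := by
      have : 0 ≤ (1 / 2 : ℝ) ^ m := by positivity
      nlinarith [mul_nonneg hη0 (sq_nonneg α)]
    exact mul_le_mul_of_nonneg_right this ht4
  -- ### the fixed point identity at every point of `(0, T) × E`
  have hfix : ∀ t ∈ Ioo 0 T, ∀ x, ulim t x = heatTest ν u₀ t x -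
      ∫ τ in Ioo 0 t, ∫ y, oseenKernel (ν * (t - τ)) (x - y) (ulim τ y) (ulim τ y) := by
    intro t ht x
    have ht2 : 0 ≤ t ^ (-(1 / 2 : ℝ)) := Real.rpow_nonneg ht.1.le _
    -- `B(u_n, u_n)(t)(x) → B(u, u)(t)(x)`
    have hbd : ∀ n, ‖(∫ τ in Ioo 0 t, ∫ y, oseenKernel (ν * (t - τ)) (x - y) (useq n τ y) (useq n τ y)) -
        ∫ τ in Ioo 0 t, ∫ y, oseenKernel (ν * (t - τ)) (x - y) (ulim τ y) (ulim τ y)‖ ≤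
        (c₂ * ν ^ (-(3 / 4 : ℝ)) * (8 * (η * α ^ 2) * (α + β₀)) * t ^ (-(1 / 2 : ℝ))) * (1 / 2 : ℝ) ^ n := by
      intro n
      have h := (S2 hν (hm n) hulim_m (t₁ := T) (a := 2 * α) (b := 2 * (α + β₀)) (a' := 2 * α)
        (b' := 2 * (α + β₀)) (e := 2 * (η * α ^ 2) * (1 / 2 : ℝ) ^ n)
        (f := 2 * (η * α * (α + β₀)) * (1 / 2 : ℝ) ^ n)
        (by positivity) (by positivity) (by positivity) (by positivity) (by positivity) (by positivity)
        (gb n).2.1 (gb n).2.2 hulim_6 hulim_i (htail6 n) (htail_pt n)).2.2 t ht x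
      refine h.trans (le_of_eq ?_)
      ring
    have hB : Tendsto (fun n => ∫ τ in Ioo 0 t, ∫ y, oseenKernel (ν * (t - τ)) (x - y) (useq n τ y) (useq n τ y))
        atTop (𝓝 (∫ τ in Ioo 0 t, ∫ y, oseenKernel (ν * (t - τ)) (x - y) (ulim τ y) (ulim τ y))) := by
      rw [tendsto_iff_norm_sub_tendsto_zero]
      have hgeo : Tendsto (fun n : ℕ => (c₂ * ν ^ (-(3 / 4 : ℝ)) * (8 * (η * α ^ 2) * (α + β₀)) *
          t ^ (-(1 / 2 : ℝ))) * (1 / 2 : ℝ) ^ n) atTop (𝓝 0) := by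
        have h := (tendsto_pow_atTop_nhds_zero_of_lt_one (by norm_num : (0 : ℝ) ≤ 1 / 2)
          (by norm_num : (1 / 2 : ℝ) < 1)).const_mul
          (c₂ * ν ^ (-(3 / 4 : ℝ)) * (8 * (η * α ^ 2) * (α + β₀)) * t ^ (-(1 / 2 : ℝ)))
        rwa [mul_zero] at h
      exact squeeze_zero (fun n => norm_nonneg _) hbd hgeo
    have h1 : Tendsto (fun n => useq (n + 1) t x) atTop (𝓝 (ulim t x)) :=
      (hconv t ht x).comp (tendsto_add_atTop_nat 1)
    have h2 : Tendsto (fun n => useq (n + 1) t x) atTop (𝓝 (heatTest ν u₀ t x -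
        ∫ τ in Ioo 0 t, ∫ y, oseenKernel (ν * (t - τ)) (x - y) (ulim τ y) (ulim τ y))) := by
      have heq : (fun n => useq (n + 1) t x) = fun n => heatTest ν u₀ t x -
          ∫ τ in Ioo 0 t, ∫ y, oseenKernel (ν * (t - τ)) (x - y) (useq n τ y) (useq n τ y) :=
        funext fun n => huseq_succ_apply n t x
      rw [heq]
      exact tendsto_const_nhds.sub hB
    exact tendsto_nhds_unique h1 h2
  -- ### conclusion
  exact ⟨ulim, hulim_m, hulim0, hfix, hulim_6, hulim_i,
    fun {t₁ α₁} ht₁ hα₁ hs₁ hU₁ => hulim_6loc ht₁ hα₁ (h8of hs₁) hU₁⟩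

end Iteration

end Literature.Analysis.FluidPDE

end
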